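import Summits.CriticalPhenomena.PercolationContinuityZ3.Theorems.PercNearOneGluingNoHeavyQuantAD3TripleSplit
import HarnessLib

/-!
# QUANT lane R8, T-DEC, ROUTE 2: the cell `AD3GateCell` REDUCED to its 4-atom core — the gate of a pair and of a triple through `0` are
# AD3⁺-decomposable (kernel), so `AD3GateCell ⟸ AD3GateTriple4` (the `q₀`-gate of an admissible triple `{s₁, s₂, s₃}` with `s₁ > 0`)

builds on p205010 (kernel theorem, internal audit signed; external expert review pending)

Support file (`--supports stmt-CriticalPhenomena-4575`), QUANT lane, TYPER seat prim-quant-stmt (gen 31), rung R8 of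
`run/shared/lean/prim/quant/LADDER.md`; continues `…QuantTreeBuiltAD3Cells` (`AD3GateCell`, `AD3ProdCell`, `treeBuiltAD3_of_cells`) and
`…QuantAD3TripleSplit` (`ad3Decomp_of_admissibleTriple`, the explicit gated small laws).  One `@[conjecture]` (the reduced cell), theorems with
standard axioms, no sorries.

* `LawDec.ad3Decomp_gate_pair` — for a two-point law `{lo, hi; γ}` (`lo ≤ hi ≤ M`) whose `(q·q₀)`-gated version is DEC at every layer at floor
  `y < q·q₀` (`y ≤ q`), the `q₀`-gated law admits an AD3⁺ decomposition at `(y, q, q₀T, M)`: a point mass gates to a zero pair (heavy); a pair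
  through `0` gates to a zero pair (heavy or light with the same datum, `gate_gate`); a genuine pair `0 < lo < hi` with `0 < γ < 1`, `q₀ < 1`
  gates to a positive triple through `0`, admissible by `gate_gate`, AD3⁺ by `ad3Decomp_of_admissibleTriple`; `q₀ = 1` is the pair itself.
* `LawDec.ad3Decomp_gate_triple_zero` — a positive admissible triple through `0` gates to a positive admissible triple through `0`.
* `LawDec.AD3GateTriple4` (`@[conjecture]`) — the remaining case: `0 < s₁ < s₂ < s₃ ≤ M`, `q₀ < 1`, `s₁ < q₀T` (a genuine 4-atom law `{0, s₁, s₂, s₃}`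
  with a positive atom below its mean; `q₀T ≤ s₁` is `ad3Decomp_of_zeroOrBig`).
  EXACT CENSUS (typer g31, `explore/ad3_gatecell.py`, triples incl. this family): 4 703 / 0.
* **`LawDec.ad3GateCell_of_triple4 : AD3GateTriple4 → AD3GateCell`**, hence
  **`farTreeRow_of_AD3Cells4 : AD3GateTriple4 → AD3ProdCell → Quant.FarTreeRow`**.
HONEST STATUS: `AD3GateTriple4`, `AD3ProdCell`, `TreeBuiltAD3`, `FarTreeRow` OPEN; RATE class log\* / honest sentence unchanged.

[this work] (this lane).  The gluing rows served [cite: KozmaNitzan2024, Conjecture 3 (p. 15)]; product measure [cite: Grimmett1999, §1.3 p. 10].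
-/

noncomputable section

namespace Summit.CriticalPhenomena.PercolationContinuityZ3.Theorems

namespace Quant

open Finset

/-- two-point law notation `TP[lo, hi, g, h] = g·[h = hi] + (1 − g)·[h = lo]` (as in the lane's other files). -/
local notation3 "TP[" lo ", " hi ", " g ", " h "]" =>
  (g : ℝ) * (if (h : ℕ) = (hi : ℕ) then (1 : ℝ) else 0) + (1 - (g : ℝ)) * (if (h : ℕ) = (lo : ℕ) then (1 : ℝ) else 0)

/-- three-atom law notation `TR[s₁, s₂, s₃, p₁, p₂, p₃, h] = p₁·[h = s₁] + p₂·[h = s₂] + p₃·[h = s₃]`. -/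
local notation3 "TR[" s₁ ", " s₂ ", " s₃ ", " p₁ ", " p₂ ", " p₃ ", " h "]" =>
  (p₁ : ℝ) * (if (h : ℕ) = (s₁ : ℕ) then (1 : ℝ) else 0) + (p₂ : ℝ) * (if (h : ℕ) = (s₂ : ℕ) then (1 : ℝ) else 0)
    + (p₃ : ℝ) * (if (h : ℕ) = (s₃ : ℕ) then (1 : ℝ) else 0)

namespace LawDec

/-! ### The gate of a pair -/

/-- a zero pair `{0, s; g}` (`s ≤ M`, `0 ≤ g ≤ 1`) with `y ≤ q·g` is a (heavy) AD3⁺ component at `(y, q, s·g, M)`. [this work] -/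
theorem isAD3Component_zeroPair_heavy (y q g : ℝ) (M s : ℕ) (hs : s ≤ M) (hg0 : 0 ≤ g) (hg1 : g ≤ 1) (hheavy : y ≤ q * g) :
    IsAD3Component y q ((s : ℝ) * g) M (fun h => TP[0, s, g, h]) :=
  Or.inl ⟨0, s, g, Nat.zero_le s, hs, hg0, hg1, hheavy, by push_cast; ring, rfl⟩

/-- **THE GATE OF A PAIR IS AD3⁺-DECOMPOSABLE.**  `lo ≤ hi ≤ M`, `0 ≤ γ ≤ 1`, mean `T = lo + (hi − lo)γ`; floor `0 < y`, gates `0 < q ≤ 1`,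
`0 < q₀ ≤ 1`, `y < q·q₀`; the `(q·q₀)`-gated pair DEC at every layer `j′ < M` at floor `y`.  Then `AD3Decomp y q (q₀T) M (gate{lo, hi; γ} q₀)`.
[this work] -/
theorem ad3Decomp_gate_pair (y q q₀ γ T : ℝ) (M lo hi : ℕ) (hy0 : 0 < y) (hq0 : 0 < q) (hq₀0 : 0 < q₀) (hq₀1 : q₀ ≤ 1)
    (hyqq : y < q * q₀) (hlohi : lo ≤ hi) (hhi : hi ≤ M) (hγ0 : 0 ≤ γ) (hγ1 : γ ≤ 1)
    (hmean : (lo : ℝ) + ((hi : ℝ) - lo) * γ = T)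
    (hD : ∀ j', j' < M → DECAt y j' M (gate (fun h => TP[lo, hi, γ, h]) (q * q₀))) :
    AD3Decomp y q (q₀ * T) M (gate (fun h => TP[lo, hi, γ, h]) q₀) := by
  have hyq : y ≤ q := hyqq.le.trans (by nlinarith)
  have hyqq₀ : y ≤ q * q₀ := hyqq.le
  rcases hlohi.eq_or_lt with heq | hlt
  · -- point mass `δ_lo`: gates to the zero pair `{0, lo; q₀}`
    subst heq
    rw [gate_TP_point]
    have eT : q₀ * T = (lo : ℝ) * q₀ := by rw [← hmean]; ring
    rw [eT]
    exact ad3Decomp_of_component (isAD3Component_zeroPair_heavy y q q₀ M lo hhi hq₀0.le hq₀1 hyqq₀)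
  rcases Nat.eq_zero_or_pos lo with hlo | hlo
  · -- pair through `0`: gates to the zero pair `{0, hi; q₀γ}`
    subst hlo
    rw [gate_TP_zero]
    have eT : q₀ * T = (hi : ℝ) * (q₀ * γ) := by rw [← hmean]; push_cast; ring
    rw [eT]
    by_cases hh : y ≤ q * (q₀ * γ)
    · exact ad3Decomp_of_component
        (isAD3Component_zeroPair_heavy y q (q₀ * γ) M hi hhi (mul_nonneg hq₀0.le hγ0) (by nlinarith) hh)
    · refine ad3Decomp_of_component (Or.inr (Or.inl ⟨0, hi, q₀ * γ, hlt, hhi, mul_nonneg hq₀0.le hγ0, by nlinarith, lt_of_not_ge hh,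
        by push_cast; ring, fun j' hj' => ?_, rfl⟩))
      rw [← gate_TP_zero, gate_gate]
      exact hD j' hj'
  · -- genuine pair `0 < lo < hi`
    rcases hq₀1.eq_or_lt with hq₀ | hq₀
    · -- `q₀ = 1`: the pair itself
      subst hq₀
      rw [gate_one, one_mul]
      rw [mul_one] at hD hyqq
      by_cases hh : y ≤ q * γ
      · exact ad3Decomp_of_component (Or.inl ⟨lo, hi, γ, hlohi, hhi, hγ0, hγ1, hh, hmean, rfl⟩)
      · exact ad3Decomp_of_component (Or.inr (Or.inl ⟨lo, hi, γ, hlt, hhi, hγ0, hγ1, lt_of_not_ge hh, hmean, hD, rfl⟩))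
    rcases hγ0.eq_or_lt with hγz | hγpos
    · -- `γ = 0`: the point mass `δ_lo`
      subst hγz
      rw [TP_gate_zero, gate_TP_point]
      have eT : q₀ * T = (lo : ℝ) * q₀ := by rw [← hmean]; ring
      rw [eT]
      exact ad3Decomp_of_component (isAD3Component_zeroPair_heavy y q q₀ M lo (hlohi.trans hhi) hq₀0.le hq₀1 hyqq₀)
    rcases hγ1.eq_or_lt with hγo | hγlt
    · -- `γ = 1`: the point mass `δ_hi`
      subst hγo
      rw [TP_gate_one, gate_TP_point]
      have eT : q₀ * T = (hi : ℝ) * q₀ := by rw [← hmean]; ring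
      rw [eT]
      exact ad3Decomp_of_component (isAD3Component_zeroPair_heavy y q q₀ M hi hhi hq₀0.le hq₀1 hyqq₀)
    · -- `0 < γ < 1`, `q₀ < 1`: a positive triple through `0`, admissible at gate `q`
      rw [gate_TP_eq_TR]
      refine ad3Decomp_of_admissibleTriple y q (q₀ * T) M 0 lo hi (1 - q₀) (q₀ * (1 - γ)) (q₀ * γ) hy0 hyq hlo hlt hhi
        (by linarith) (mul_pos hq₀0 (by linarith)) (mul_pos hq₀0 hγpos) (by ring) (by rw [← hmean]; push_cast; ring) fun j' hj' => ?_
      rw [← gate_TP_eq_TR, gate_gate]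
      exact hD j' hj'

/-! ### The gate of a triple through `0` -/

/-- **THE GATE OF AN ADMISSIBLE TRIPLE THROUGH `0` IS AD3⁺-DECOMPOSABLE**: `0 < s₂ < s₃ ≤ M`, positive masses, mean `T`, the `(q·q₀)`-gated
triple DEC at every layer at floor `y < q·q₀`; then `gate{0, s₂, s₃; p} q₀ = {0, s₂, s₃; 1−q₀+q₀p₁, q₀p₂, q₀p₃}` is a positive admissible triple,
hence AD3⁺ (`ad3Decomp_of_admissibleTriple`). [this work] -/
theorem ad3Decomp_gate_triple_zero (y q q₀ T : ℝ) (M s₂ s₃ : ℕ) (p₁ p₂ p₃ : ℝ) (hy0 : 0 < y) (hq0 : 0 < q)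
    (hq₀0 : 0 < q₀) (hq₀1 : q₀ ≤ 1) (hyqq : y < q * q₀) (h02 : 0 < s₂) (h23 : s₂ < s₃) (h3 : s₃ ≤ M)
    (hp₁ : 0 < p₁) (hp₂ : 0 < p₂) (hp₃ : 0 < p₃) (hp : p₁ + p₂ + p₃ = 1)
    (hT : p₁ * ((0 : ℕ) : ℝ) + p₂ * (s₂ : ℝ) + p₃ * (s₃ : ℝ) = T)
    (hD : ∀ j', j' < M → DECAt y j' M (gate (fun h => TR[0, s₂, s₃, p₁, p₂, p₃, h]) (q * q₀))) :
    AD3Decomp y q (q₀ * T) M (gate (fun h => TR[0, s₂, s₃, p₁, p₂, p₃, h]) q₀) := by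
  have hyq : y ≤ q := hyqq.le.trans (by nlinarith)
  rw [gate_TR_zero]
  refine ad3Decomp_of_admissibleTriple y q (q₀ * T) M 0 s₂ s₃ (1 - q₀ + q₀ * p₁) (q₀ * p₂) (q₀ * p₃) hy0 hyq h02 h23 h3
    (by nlinarith [mul_pos hq₀0 hp₁]) (mul_pos hq₀0 hp₂) (mul_pos hq₀0 hp₃) (by linear_combination q₀ * hp)
    (by rw [← hT]; push_cast; ring) fun j' hj' => ?_
  rw [← gate_TR_zero, gate_gate]
  exact hD j' hj'

/-! ### The reduced cell and the reduction -/

/-- **CELL `AD3GateTriple4` (the 4-atom core of `AD3GateCell`).**  Floor `0 < y`, gates `0 < q ≤ 1`, `0 < q₀ < 1`, `y < q·q₀`,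
top-affordability `y·M ≤ q·q₀·T`; an admissible, not heavy-decomposable (at `(y, q·q₀)`) three-atom law `p₁δ_{s₁} + p₂δ_{s₂} + p₃δ_{s₃}` with
`0 < s₁ < s₂ < s₃ ≤ M`, positive masses, mean `T`, and `s₁ < q₀T` (else every positive atom of the gated law lies above its mean and
`ad3Decomp_of_zeroOrBig` applies).  Then its `q₀`-gate — the genuine 4-atom law `{0: 1−q₀, s₁: q₀p₁, s₂: q₀p₂, s₃: q₀p₃}` with `s₁` below
the mean `q₀T` — admits an AD3⁺ decomposition at `(y, q, q₀T, M)`.  EXACT CENSUS 4 703 / 0 (within `AD3GateCell`'s 9 560 / 0); the LP's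
decompositions use pairs only in 97 % of instances (zero pairs are always heavy; the `s`-pairs heavy or light-admissible), triples in ≈ 2 %.
builds on p205010 (kernel theorem, internal audit signed; external expert review pending). [this work] [status: open] -/
@[conjecture] def AD3GateTriple4 : Prop :=
  ∀ (y q q₀ T : ℝ) (M s₁ s₂ s₃ : ℕ) (p₁ p₂ p₃ : ℝ),
    0 < y → 0 < q → q ≤ 1 → 0 < q₀ → q₀ < 1 → y < q * q₀ → y * (M : ℝ) ≤ q * q₀ * T →
    0 < s₁ → s₁ < s₂ → s₂ < s₃ → s₃ ≤ M → 0 < p₁ → 0 < p₂ → 0 < p₃ → p₁ + p₂ + p₃ = 1 →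
    p₁ * (s₁ : ℝ) + p₂ * (s₂ : ℝ) + p₃ * (s₃ : ℝ) = T → (s₁ : ℝ) < q₀ * T →
    ((s₂ : ℝ) ≤ T ∧ q * q₀ * (T - s₂) < y * ((s₃ : ℝ) - s₂) ∨ T < (s₂ : ℝ) ∧ q * q₀ * (T - s₁) < y * ((s₃ : ℝ) - s₁)) →
    (∀ j', j' < M → DECAt y j' M (gate (fun h => TR[s₁, s₂, s₃, p₁, p₂, p₃, h]) (q * q₀))) →
    AD3Decomp y q (q₀ * T) M (gate (fun h => TR[s₁, s₂, s₃, p₁, p₂, p₃, h]) q₀)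

/-- **`AD3GateTriple4 ⟹ AD3GateCell`**: pairs by `ad3Decomp_gate_pair` (their admissibility at gate `q·q₀` from heaviness —
`heavyPair_gate_decAt` — or from the light datum), triples with `q₀ = 1` are themselves, triples through `0` by `ad3Decomp_gate_triple_zero`,
and the genuine 4-atom case is the reduced cell. [this work] -/
theorem ad3GateCell_of_triple4 (h4 : AD3GateTriple4) : AD3GateCell := by
  intro y q q₀ T M ω hy0 hq0 hq1 hq₀0 hq₀1 hyqq hta hcomp
  have hqq0 : 0 < q * q₀ := mul_pos hq0 hq₀0
  have hqq1 : q * q₀ ≤ 1 := by nlinarith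
  have hy1 : y < 1 := lt_of_lt_of_le hyqq hqq1
  rcases hcomp with ⟨lo, hi, γ, hlohi, hhi, hγ0, hγ1, hheavy, hmean, hω⟩ | ⟨lo, hi, γ, hlohi, hhi, hγ0, hγ1, -, hmean, hD, hω⟩ |
    ⟨s₁, s₂, s₃, p₁, p₂, p₃, h12, h23, h3, hp₁, hp₂, hp₃, hp, hT, hnotHD, hD, hω⟩
  · -- heavy pair: admissible at gate `q·q₀`
    subst hω
    have hta' : y * (M : ℝ) ≤ q * q₀ * ((lo : ℝ) + ((hi : ℝ) - lo) * γ) := by rw [hmean]; exact hta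
    exact ad3Decomp_gate_pair y q q₀ γ T M lo hi hy0 hq0 hq₀0 hq₀1 hyqq hlohi hhi hγ0 hγ1 hmean
      (heavyPair_gate_decAt y (q * q₀) γ M lo hi hy0 hy1 hqq0 hqq1 hlohi hhi hγ1 hheavy hta')
  · -- light pair with its datum
    subst hω
    exact ad3Decomp_gate_pair y q q₀ γ T M lo hi hy0 hq0 hq₀0 hq₀1 hyqq hlohi.le hhi hγ0 hγ1 hmean hD
  · -- triple
    subst hω
    rcases hq₀1.eq_or_lt with hq₀ | hq₀
    · -- `q₀ = 1`: itself
      subst hq₀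
      rw [gate_one, one_mul]
      rw [mul_one] at hD hnotHD
      exact ad3Decomp_of_component (Or.inr (Or.inr ⟨s₁, s₂, s₃, p₁, p₂, p₃, h12, h23, h3, hp₁, hp₂, hp₃, hp, hT, hnotHD, hD, rfl⟩))
    rcases Nat.eq_zero_or_pos s₁ with hs | hs
    · subst hs
      exact ad3Decomp_gate_triple_zero y q q₀ T M s₂ s₃ p₁ p₂ p₃ hy0 hq0 hq₀0 hq₀1 hyqq h12 h23 h3 hp₁ hp₂ hp₃ hp hT hD
    by_cases hbig : q₀ * T ≤ (s₁ : ℝ)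
    · -- every positive atom of the gated law lies at or above its mean `q₀T`: heavy zero pairs
      obtain ⟨t0, tM, t1, tmean⟩ := triple_laws' p₁ p₂ p₃ T M s₁ s₂ s₃ (by omega) (by omega) h3 hp₁.le hp₂.le hp₃.le hp hT
      obtain ⟨n0, nM, n1⟩ := gate_laws M (fun h => TR[s₁, s₂, s₃, p₁, p₂, p₃, h]) q₀ hq₀0.le hq₀1 t0 tM t1
      have nmean : ∑ h ∈ Finset.range (M + 1), (h : ℝ) * gate (fun h => TR[s₁, s₂, s₃, p₁, p₂, p₃, h]) q₀ h = q₀ * T := by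
        rw [sum_mul_gate, tmean]
      have hyq : y ≤ q := hyqq.le.trans (by nlinarith)
      refine ad3Decomp_of_zeroOrBig y q (q₀ * T) M _ hy0.le hq0 hyq n0 nM n1 nmean (by nlinarith) fun k hk hkT => ?_
      have hks : (k : ℝ) < s₁ := lt_of_lt_of_le hkT hbig
      have hks' : k < s₁ := by exact_mod_cast hks
      have hk1 : k ≠ s₁ := by omega
      have hk2 : k ≠ s₂ := by omega
      have hk3 : k ≠ s₃ := by omega
      simp only [gate]
      rw [if_neg hk1, if_neg hk2, if_neg hk3, if_neg (Nat.pos_iff_ne_zero.1 hk)]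
      ring
    · exact h4 y q q₀ T M s₁ s₂ s₃ p₁ p₂ p₃ hy0 hq0 hq1 hq₀0 hq₀ hyqq hta hs h12 h23 h3 hp₁ hp₂ hp₃ hp hT (lt_of_not_ge hbig) hnotHD hD

end LawDec

/-- **`AD3GateTriple4 ∧ AD3ProdCell ⟹ Quant.FarTreeRow`** — Route 2 with the gate cell reduced to its 4-atom core. [this work] -/
theorem farTreeRow_of_AD3Cells4 (h4 : LawDec.AD3GateTriple4) (hP : LawDec.AD3ProdCell) : FarTreeRow :=
  farTreeRow_of_AD3Cells (LawDec.ad3GateCell_of_triple4 h4) hP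

end Quant

end Summit.CriticalPhenomena.PercolationContinuityZ3.Theorems
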